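import Literature.NumberTheory.EllipticCurves.PAdicLFunctionTameEulerFactorSeriesProofs
import Literature.NumberTheory.EllipticCurves.PAdicBSDSplitMultiplicativeProofs
import HarnessLib

/-!
# Matsuno 2000, Lemmas 2.2 and 3.3 at a prime `ℓ` DIVIDING the level (`U_ℓ` in place of `T_ℓ`):
# `∑_{b'↦b} μ_{f,α,mℓ} = a_ℓ μ_{f,α,m}`, `L_p(f,α,𝟙_{mℓ}) = (a_ℓ − (1+T)^{c_ℓ}) · L_p(f,α,𝟙_m)`, and the depletion at a
# square-free tame level whose primes are good OR divide the level (PROOFS ONLY: no `def`, no named fact)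

Cell bsd-2adic, seat conv-1 (GEN 16; road «S3 twist road without the coprimality `(d, N_E) = 1` at the multiplicative
primes of `E`»). The tree's tame chain (`PAdicLFunctionTameProofs.sum_filter_msdMeasureTame`,
`PAdicLFunctionTameUnitLevelChangeProofs.weighted_msdMeasureTame_levelChange`,
`PAdicLFunctionTameEulerFactorProofs.padicLCoeffTame_mul_prime`, `PAdicLFunctionTameEulerFactorSeriesProofs`) raises the
tame level by a GOOD prime `ℓ ∤ N`, through the Hecke relation `a_ℓ[x]⁺ = ∑_j[(x+j)/ℓ]⁺ + [ℓx]⁺`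
(`intCast_mul_ratPlusSymbol`). At a prime `ℓ ∣ N` the newform is an eigenvector of `U_ℓ` and the relation loses its last
term, `a_ℓ[x]⁺ = ∑_j[(x+j)/ℓ]⁺` (`intCast_mul_ratPlusSymbol_of_dvd`, Mazur–Tate–Teitelbaum §I.4 (4.2) with `ε(ℓ) = 0`).
This file runs the same chain on that relation:

* §1 `sum_ratPlusSymbol_tameFraction_lift_of_dvd` — the core reindexing identity over the `ℓ` lifts `c + pⁿmu` of the CRT
  representative (Matsuno's proof of Lemma 2.2), ONE-TERM form: `∑_u [k·c'_u/(pⁿmℓ)]⁺ = a_ℓ·[k·c/(pⁿm)]⁺`;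
* §2 `sum_msdMeasureTame_lift_of_dvd`, `sum_filter_msdMeasureTame_of_dvd` — `∑_{b'↦b} μ_{f,α,mℓ}((a+pⁿℤ_p)×{b'}) =
  a_ℓ μ_{f,α,m}((a+pⁿℤ_p)×{b})` (Lemma 2.2 with `ε(ℓ) = 0`);
* §3 `weighted_msdMeasureTame_levelChange_of_dvd` — for the `𝟙`-weighted measure `W_m(n,a) = ∑_b 𝟙_m(b) μ_{f,α,m}((a+pⁿℤ_p)×{b})`:
  `W_{mℓ}(n, a) = a_ℓ·W_m(n, a) − W_m(n, ℓ⁻¹a)` (the class `b' ≡ 0 (mod ℓ)` subtracted through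
  `msdMeasureTame_lift_dvd`);
* §4 `padicLCoeffTame_mul_prime_of_dvd`, `padicLFunctionTame_mul_prime_of_dvd`,
  `iwasawaToPowerSeries_tameEulerFactor_mul_of_dvd` — Matsuno's Lemma 3.3 at `ℓ ∣ N`:
  `L_p(f,α,𝟙_{mℓ}) = (a_ℓ − (1+T)^{c_ℓ}) · L_p(f,α,𝟙_m)` (`ℓ ≡ η_ℓγ^{c_ℓ}`; his `h_ℓ = a_ℓ − φ⁻¹(ℓ)(1+T)^{−t(ℓ)} − ε(ℓ)φ(ℓ)(1+T)^{t(ℓ)}`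
  with `ε(ℓ) = 0`, in the tree's orientation), and its `Λ`-form;
* §5 `padicLFunctionTame_prod_primes_sqfreeAt`, `iwasawaToPowerSeries_prod_tameEulerFactor_mul_sqfreeAt` — the depletion at
  a square-free tame level `m = ∏_{ℓ∈S} ℓ` whose primes are prime to `p` and EITHER prime to `N` OR divide `N`:
  `L_p(f,α,𝟙_m) = ∏_{ℓ∈S} h_ℓ · L_p(f,α)` with `h_ℓ = a_ℓ − (1+T)^{c_ℓ} − [ℓ ∤ N]·(1+T)^{−c_ℓ}`.

For the newform of an elliptic curve the primes `ℓ ∣ N`, `ℓ² ∤ N` are the multiplicative ones (`a_ℓ = ±1`); the factor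
`±1 − (1+T)^{c_ℓ}` has `μ = 0` and `λ = 2^{v₂(c_ℓ)}` (at `p = 2`: the number of primes of `ℚ_∞` above `ℓ`, Matsuno 2008's
local term `d̄_{E,ℓ} = 1`). Everything is proved; nothing is asserted.

References: K. Matsuno, J. Number Theory 84 (2000), Lemma 2.2 (p. 85), Lemma 3.3 (pp. 87–88: `ε(ℓ) = 0` for `ℓ ∣ N`)
[Matsuno2000]; B. Mazur, J. Tate, J. Teitelbaum, Invent. Math. 84 (1986), §I.4 (4.2), §I.10, §I.13
[MazurTateTeitelbaum1986Invent]; B. Mazur, P. Swinnerton-Dyer, Invent. Math. 25 (1974), §8 Lemma 2 [MazurSwinnertonDyer1974Invent].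
-/

noncomputable section

open scoped MatrixGroups ModularForm

open CongruenceSubgroup Filter Topology PowerSeries Literature.NumberTheory.EllipticCurves.ModularForms

namespace Literature.NumberTheory.EllipticCurves

/-! ## §1. The reindexing lemma with the `U_ℓ`-relation -/

section Lift

variable {N : ℕ} [NeZero N] {f : CuspForm (Gamma0 N) 2} {p m ℓ n : ℕ}

/-- Two naturals with the same residues mod `pⁿ` and mod `m` (coprime) agree mod `pⁿm`; private helper. [folklore] -/
private theorem intCast_dvd_sub_of_natCast_eq' (hmp : m.Coprime p) {c c' : ℕ}
    (h1 : (c : ZMod (p ^ n)) = c') (h2 : (c : ZMod m) = c') :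
    ((p ^ n * m : ℕ) : ℤ) ∣ (c : ℤ) - c' := by
  have h1' : c ≡ c' [MOD p ^ n] := (ZMod.natCast_eq_natCast_iff _ _ _).mp h1
  have h2' : c ≡ c' [MOD m] := (ZMod.natCast_eq_natCast_iff _ _ _).mp h2
  have h : c ≡ c' [MOD p ^ n * m] :=
    (Nat.modEq_and_modEq_iff_modEq_mul (hmp.symm.pow_left n)).mp ⟨h1', h2'⟩
  exact Nat.modEq_iff_dvd.mp h.symm

/-- `u ↦ k·u mod ℓ` is a bijection of `Fin ℓ` for `k` coprime to `ℓ`; private helper. [folklore] -/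
private theorem bijective_mul_mod' (hℓ : 0 < ℓ) {k : ℕ} (hk : k.Coprime ℓ) :
    Function.Bijective (fun u : Fin ℓ => (⟨k * u % ℓ, Nat.mod_lt _ hℓ⟩ : Fin ℓ)) := by
  refine (Finite.injective_iff_bijective).mp fun u u' h => ?_
  have h' : k * u % ℓ = k * u' % ℓ := by simpa using congrArg Fin.val h
  have hmod : (u : ℕ) ≡ u' [MOD ℓ] :=
    Nat.ModEq.cancel_left_of_coprime (by simpa [Nat.coprime_comm] using hk) h'
  exact Fin.ext (by
    have := hmod
    rw [Nat.ModEq, Nat.mod_eq_of_lt u.isLt, Nat.mod_eq_of_lt u'.isLt] at this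
    exact this)

/-- **Core identity at a prime `ℓ ∣ N`** (Matsuno 2000, proof of Lemma 2.2, with the `U_ℓ`-relation): with `c` the CRT
representative of `(a, b)` at level `m` and `c'_u` that of `(a, c + pⁿmu)` at level `mℓ`, for `k` coprime to `ℓ`:
`∑_{u<ℓ} [k·c'_u/(pⁿmℓ)]⁺ = a_ℓ·[k·c/(pⁿm)]⁺` — the `ℓ` lifted fractions are `(x + ku)/ℓ`, `x = kc/(pⁿm)`, `u ↦ ku mod ℓ`
permutes `ℤ/ℓ`, and `∑_j [(x+j)/ℓ]⁺ = a_ℓ[x]⁺` (`intCast_mul_ratPlusSymbol_of_dvd`).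
[cite: Matsuno2000, Lemma 2.2 (p. 85), proof] [cite: MazurTateTeitelbaum1986Invent, §I.4 (4.2)] -/
theorem sum_ratPlusSymbol_tameFraction_lift_of_dvd [NeZero m] [NeZero (m * ℓ)] (hp : p.Prime) (hf : IsNewform0 f)
    (hrat : ∀ r : ℚ, (ratPlusSymbol f r : ℝ) = normalizedPlusSymbol f r) (hℓ : ℓ.Prime) (hℓN : ℓ ∣ N)
    {aℓ : ℤ} (haℓ : cuspCoeff f ℓ = aℓ) (hmp : m.Coprime p) (hℓp : ℓ.Coprime p)
    (a : ZMod (p ^ n)) (b : ZMod m) {k : ℕ} (hk : k.Coprime ℓ) :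
    ∑ u : Fin ℓ, ratPlusSymbol f ((k : ℚ) *
        tameFraction p (m * ℓ) n a ((tameRep p m n a b + p ^ n * m * (u : ℕ) : ℕ) : ZMod (m * ℓ))) =
      (aℓ : ℚ) * ratPlusSymbol f ((k : ℚ) * tameFraction p m n a b) := by
  have hmℓp : (m * ℓ).Coprime p := Nat.Coprime.mul_left hmp hℓp
  haveI : NeZero ℓ := ⟨hℓ.ne_zero⟩
  have hM1 : p ^ n * (m * ℓ) ≠ 0 := mul_ne_zero (pow_ne_zero _ hp.ne_zero) (mul_ne_zero (NeZero.ne m) hℓ.ne_zero)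
  have hp0 : (p : ℚ) ^ n ≠ 0 := pow_ne_zero _ (by exact_mod_cast hp.ne_zero)
  have hm0 : (m : ℚ) ≠ 0 := by exact_mod_cast (NeZero.ne m)
  have hℓ0 : (ℓ : ℚ) ≠ 0 := by exact_mod_cast hℓ.ne_zero
  set c := tameRep p m n a b with hc
  set x : ℚ := (k : ℚ) * tameFraction p m n a b with hx
  have hterm : ∀ u : Fin ℓ, ratPlusSymbol f ((k : ℚ) *
      tameFraction p (m * ℓ) n a ((c + p ^ n * m * (u : ℕ) : ℕ) : ZMod (m * ℓ))) =
      ratPlusSymbol f ((x + ((k * u % ℓ : ℕ) : ℚ)) / ℓ) := by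
    intro u
    set b' : ZMod (m * ℓ) := ((c + p ^ n * m * (u : ℕ) : ℕ) : ZMod (m * ℓ)) with hb'
    set c' := tameRep p (m * ℓ) n a b' with hc'
    have h1 : (c' : ZMod (p ^ n)) = ((c + p ^ n * m * (u : ℕ) : ℕ) : ZMod (p ^ n)) := by
      rw [hc', natCast_tameRep_left hp hmℓp, Nat.cast_add, hc, natCast_tameRep_left hp hmp]
      haveI : NeZero (p ^ n) := ⟨pow_ne_zero _ hp.ne_zero⟩
      rw [Nat.cast_mul, Nat.cast_mul, ZMod.natCast_self, zero_mul, zero_mul, add_zero]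
    have h2 : (c' : ZMod (m * ℓ)) = ((c + p ^ n * m * (u : ℕ) : ℕ) : ZMod (m * ℓ)) := by
      rw [hc', natCast_tameRep_right hmℓp]
    have hdvd := intCast_dvd_sub_of_natCast_eq' (n := n) hmℓp h1 h2
    have hfrac : tameFraction p (m * ℓ) n a b' = ((c' : ℤ) : ℚ) / ((p ^ n * (m * ℓ) : ℕ) : ℚ) := by
      rw [tameFraction, ← hc']
      push_cast
      ring
    rw [hfrac, ratPlusSymbol_mul_div_eq_of_dvd_sub f hM1 hdvd k]
    have hS2 : (k : ℚ) * ((((c + p ^ n * m * (u : ℕ) : ℕ) : ℤ) : ℚ) / ((p ^ n * (m * ℓ) : ℕ) : ℚ)) =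
        (x + ((k * u : ℕ) : ℚ)) / ℓ := by
      rw [hx, tameFraction]
      push_cast
      field_simp
      ring
    have hdm : (k * (u : ℕ) : ℕ) = k * u % ℓ + ℓ * (k * u / ℓ) := (Nat.mod_add_div (k * u) ℓ).symm
    generalize hq : k * (u : ℕ) / ℓ = q at hdm
    generalize hr : k * (u : ℕ) % ℓ = r at hdm ⊢
    have hS3 : (x + ((k * u : ℕ) : ℚ)) / ℓ = (x + (r : ℚ)) / ℓ + ((q : ℕ) : ℤ) := by
      rw [hdm]
      push_cast
      field_simp
      ring
    rw [hS2, hS3, ratPlusSymbol_add_intCast_eq]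
  simp_rw [hterm]
  have hS4 : ∑ u : Fin ℓ, ratPlusSymbol f ((x + ((k * u % ℓ : ℕ) : ℚ)) / ℓ) =
      ∑ j : Fin ℓ, ratPlusSymbol f ((x + j) / ℓ) :=
    (bijective_mul_mod' hℓ.pos hk).sum_comp (fun j : Fin ℓ => ratPlusSymbol f ((x + j) / ℓ))
  rw [hS4]
  exact (intCast_mul_ratPlusSymbol_of_dvd ℓ hf hℓ hℓN haℓ hrat x).symm

end Lift

/-! ## §2. Matsuno's Lemma 2.2 at `ℓ ∣ N` (one-term form over all `ℓ` lifts) -/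

section LevelChange

variable {N : ℕ} [NeZero N] (f : CuspForm (Gamma0 N) 2) {p : ℕ} [Fact p.Prime] {m ℓ n : ℕ}

/-- **Change of tame level at `ℓ ∣ N`** (Matsuno 2000 Lemma 2.2 with `ε(ℓ) = 0`): with `b'_u = c + pⁿmu (mod mℓ)` the `ℓ`
classes over `b`, `∑_u μ_{f,α,mℓ}((a + pⁿℤ_p) × {b'_u}) = a_ℓ · μ_{f,α,m}((a + pⁿℤ_p) × {b})`.
[cite: Matsuno2000, Lemma 2.2 (p. 85)] [cite: MazurTateTeitelbaum1986Invent, §I.10 (10.1)] -/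
theorem sum_msdMeasureTame_lift_of_dvd [NeZero m] [NeZero (m * ℓ)] (hf : IsNewform0 f)
    (hrat : ∀ r : ℚ, (ratPlusSymbol f r : ℝ) = normalizedPlusSymbol f r) (hℓ : ℓ.Prime) (hℓN : ℓ ∣ N)
    {aℓ : ℤ} (haℓ : cuspCoeff f ℓ = aℓ) (hmp : m.Coprime p) (hℓp : ℓ.Coprime p)
    (α : ℚ_[p]) (a : ZMod (p ^ n)) (b : ZMod m) :
    ∑ u : Fin ℓ, msdMeasureTame f (m * ℓ) α n a ((tameRep p m n a b + p ^ n * m * (u : ℕ) : ℕ) : ZMod (m * ℓ)) =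
      (aℓ : ℚ_[p]) * msdMeasureTame f m α n a b := by
  have hp : p.Prime := Fact.out
  have h1 := sum_ratPlusSymbol_tameFraction_lift_of_dvd (n := n) hp hf hrat hℓ hℓN haℓ hmp hℓp a b
    (Nat.coprime_one_left ℓ)
  have hP := sum_ratPlusSymbol_tameFraction_lift_of_dvd (n := n) hp hf hrat hℓ hℓN haℓ hmp hℓp a b hℓp.symm
  simp only [Nat.cast_one, one_mul] at h1
  have h1' := congrArg (fun q : ℚ => (q : ℚ_[p])) h1
  have hP' := congrArg (fun q : ℚ => (q : ℚ_[p])) hP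
  simp only [Rat.cast_sum, Rat.cast_mul, Rat.cast_intCast] at h1' hP'
  simp only [msdMeasureTame, Finset.sum_sub_distrib, ← Finset.mul_sum, h1', hP']
  ring

/-- **Matsuno 2000 Lemma 2.2 at `ℓ ∣ N`, filter form**: `∑_{b' ↦ b} μ_{f,α,mℓ}((a + pⁿℤ_p) × {b'}) = a_ℓ μ_{f,α,m}((a + pⁿℤ_p) × {b})`
(`ℓ` prime to `p` and to `m`; rationality `hrat` of the plus symbols). [cite: Matsuno2000, Lemma 2.2 (p. 85)]
[cite: MazurSwinnertonDyer1974Invent, §8 Lemma 2] -/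
theorem sum_filter_msdMeasureTame_of_dvd [NeZero m] [NeZero (m * ℓ)] (hf : IsNewform0 f)
    (hrat : ∀ r : ℚ, (ratPlusSymbol f r : ℝ) = normalizedPlusSymbol f r) (hℓ : ℓ.Prime) (hℓN : ℓ ∣ N)
    {aℓ : ℤ} (haℓ : cuspCoeff f ℓ = aℓ) (hmp : m.Coprime p) (hℓp : ℓ.Coprime p) (hℓm : ℓ.Coprime m)
    (α : ℚ_[p]) (a : ZMod (p ^ n)) (b : ZMod m) :
    ∑ b' ∈ Finset.univ.filter (fun b' : ZMod (m * ℓ) => ZMod.castHom (dvd_mul_right m ℓ) (ZMod m) b' = b),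
        msdMeasureTame f (m * ℓ) α n a b' = (aℓ : ℚ_[p]) * msdMeasureTame f m α n a b := by
  rw [filter_castHom_eq_image_lift hℓ hℓp hℓm hmp a b,
    Finset.sum_image fun u _ u' _ h => lift_injective (n := n) hℓp hℓm _ h]
  exact sum_msdMeasureTame_lift_of_dvd f hf hrat hℓ hℓN haℓ hmp hℓp α a b

end LevelChange

/-! ## §3. The level change of the `𝟙`-weighted measure at `ℓ ∣ N` -/

section Weighted

variable {p m ℓ n : ℕ}

/-- Two classes mod `mℓ` with the same residues mod `m` and mod `ℓ` (coprime) coincide; private helper. [folklore] -/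
private theorem eq_of_castHom_eq_castHom_dvd [NeZero (m * ℓ)] (hℓm : ℓ.Coprime m) {x y : ZMod (m * ℓ)}
    (hm : ZMod.castHom (dvd_mul_right m ℓ) (ZMod m) x = ZMod.castHom (dvd_mul_right m ℓ) (ZMod m) y)
    (hℓ : ZMod.castHom (dvd_mul_left ℓ m) (ZMod ℓ) x = ZMod.castHom (dvd_mul_left ℓ m) (ZMod ℓ) y) : x = y := by
  rw [← ZMod.natCast_zmod_val x, ← ZMod.natCast_zmod_val y] at hm hℓ ⊢
  rw [map_natCast, map_natCast] at hm hℓ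
  have h1 : x.val ≡ y.val [MOD m] := (ZMod.natCast_eq_natCast_iff _ _ _).mp hm
  have h2 : x.val ≡ y.val [MOD ℓ] := (ZMod.natCast_eq_natCast_iff _ _ _).mp hℓ
  exact (ZMod.natCast_eq_natCast_iff _ _ _).mpr ((Nat.modEq_and_modEq_iff_modEq_mul hℓm.symm).mp ⟨h1, h2⟩)

/-- A class mod `mℓ` is a unit iff its residues mod `m` and mod `ℓ` are units; private helper. [folklore] -/
private theorem isUnit_iff_isUnit_castHom_and_dvd [NeZero m] [NeZero ℓ] [NeZero (m * ℓ)] (x : ZMod (m * ℓ)) :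
    IsUnit x ↔ IsUnit (ZMod.castHom (dvd_mul_right m ℓ) (ZMod m) x) ∧
      IsUnit (ZMod.castHom (dvd_mul_left ℓ m) (ZMod ℓ) x) := by
  obtain ⟨k, rfl⟩ : ∃ k : ℕ, (k : ZMod (m * ℓ)) = x := ⟨x.val, ZMod.natCast_zmod_val x⟩
  rw [map_natCast, map_natCast, ZMod.isUnit_iff_coprime, ZMod.isUnit_iff_coprime, ZMod.isUnit_iff_coprime,
    Nat.coprime_mul_iff_right]

/-- The lift of `b mod m` to the class `≡ 0 (mod ℓ)` of `ℤ/mℓ` is `ℓ · (bℓ⁻¹)`; private helper. [folklore] -/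
private theorem castHom_liftZero_dvd [NeZero m] [NeZero (m * ℓ)] (hℓm : ℓ.Coprime m) (b : ZMod m) :
    ZMod.castHom (dvd_mul_right m ℓ) (ZMod m) ((ℓ : ZMod (m * ℓ)) * (((b * (ℓ : ZMod m)⁻¹).val : ℕ) : ZMod (m * ℓ))) = b ∧
    ZMod.castHom (dvd_mul_left ℓ m) (ZMod ℓ) ((ℓ : ZMod (m * ℓ)) * (((b * (ℓ : ZMod m)⁻¹).val : ℕ) : ZMod (m * ℓ))) = 0 := by
  have hℓu : IsUnit (ℓ : ZMod m) := by rw [ZMod.isUnit_iff_coprime]; exact hℓm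
  constructor
  · rw [map_mul, map_natCast, map_natCast, ZMod.natCast_zmod_val, mul_comm, mul_assoc, ZMod.inv_mul_of_unit _ hℓu, mul_one]
  · rw [map_mul, map_natCast, ZMod.natCast_self, zero_mul]

/-- The classes `≡ 0 (mod ℓ)` of `ℤ/mℓ` are the lifts `ℓ·(bℓ⁻¹)`, `b ∈ ℤ/m`; private helper. [folklore] -/
private theorem filter_castHom_ell_eq_zero_eq_image_dvd [NeZero m] [NeZero (m * ℓ)] (hℓm : ℓ.Coprime m) :
    Finset.univ.filter (fun b' : ZMod (m * ℓ) => ZMod.castHom (dvd_mul_left ℓ m) (ZMod ℓ) b' = 0) =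
      Finset.univ.image (fun b : ZMod m => (ℓ : ZMod (m * ℓ)) * (((b * (ℓ : ZMod m)⁻¹).val : ℕ) : ZMod (m * ℓ))) := by
  classical
  ext b'
  simp only [Finset.mem_filter, Finset.mem_univ, true_and, Finset.mem_image]
  constructor
  · intro hb'
    refine ⟨ZMod.castHom (dvd_mul_right m ℓ) (ZMod m) b', ?_⟩
    obtain ⟨h1, h2⟩ := castHom_liftZero_dvd (ℓ := ℓ) hℓm (ZMod.castHom (dvd_mul_right m ℓ) (ZMod m) b')
    exact eq_of_castHom_eq_castHom_dvd hℓm h1 (h2.trans hb'.symm)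
  · rintro ⟨b, rfl⟩
    exact (castHom_liftZero_dvd hℓm b).2

variable {N : ℕ} [NeZero N] (f : CuspForm (Gamma0 N) 2) [Fact p.Prime]

/-- **Level change of the `𝟙`-weighted tame measure at `ℓ ∣ N`** (Matsuno 2000 Lemma 2.2 in unit-class form with `ε(ℓ) = 0`,
summed over the units): with `W_m(n, a) = ∑_{b mod m} 𝟙_m(b) μ_{f,α,m}((a + pⁿℤ_p) × {b})`, for a prime `ℓ ∣ N` prime to `p` and
to `m`: `W_{mℓ}(n, a) = a_ℓ·W_m(n, a) − W_m(n, ℓ⁻¹a)` (the lift `b' ≡ 0 (mod ℓ)` over `b` contributes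
`μ_{f,α,m}((ℓ⁻¹a + pⁿℤ_p) × {ℓ⁻¹b})`, `msdMeasureTame_lift_dvd`). The `ℓ ∣ N` companion of `weighted_msdMeasureTame_levelChange`.
[cite: Matsuno2000, Lemma 2.2 (p. 85) and Lemma 3.3 (pp. 87–88)] [cite: MazurSwinnertonDyer1974Invent, §8 Lemma 2] -/
theorem weighted_msdMeasureTame_levelChange_of_dvd [NeZero m] [NeZero (m * ℓ)] (hf : IsNewform0 f)
    (hrat : ∀ r : ℚ, (ratPlusSymbol f r : ℝ) = normalizedPlusSymbol f r) (hℓ : ℓ.Prime) (hℓN : ℓ ∣ N)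
    {aℓ : ℤ} (haℓ : cuspCoeff f ℓ = aℓ) (hmp : m.Coprime p) (hℓp : ℓ.Coprime p) (hℓm : ℓ.Coprime m)
    (α : ℚ_[p]) (a : ZMod (p ^ n)) :
    ∑ b' : ZMod (m * ℓ), (1 : DirichletCharacter ℚ_[p] (m * ℓ)) b' * msdMeasureTame f (m * ℓ) α n a b' =
      (aℓ : ℚ_[p]) * ∑ b : ZMod m, (1 : DirichletCharacter ℚ_[p] m) b * msdMeasureTame f m α n a b -
        ∑ b : ZMod m, (1 : DirichletCharacter ℚ_[p] m) b * msdMeasureTame f m α n (a * (ℓ : ZMod (p ^ n))⁻¹) b := by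
  classical
  haveI : NeZero ℓ := ⟨hℓ.ne_zero⟩
  haveI : Fact ℓ.Prime := ⟨hℓ⟩
  have hℓu : IsUnit (ℓ : ZMod m) := by rw [ZMod.isUnit_iff_coprime]; exact hℓm
  -- Step A: `𝟙_{mℓ}(b') = 𝟙_m(b̄') − [ℓ ∣ b']·𝟙_m(b̄')`
  have hA : ∀ b' : ZMod (m * ℓ), (1 : DirichletCharacter ℚ_[p] (m * ℓ)) b' =
      (1 : DirichletCharacter ℚ_[p] m) (ZMod.castHom (dvd_mul_right m ℓ) (ZMod m) b') -
        (if ZMod.castHom (dvd_mul_left ℓ m) (ZMod ℓ) b' = 0 then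
          (1 : DirichletCharacter ℚ_[p] m) (ZMod.castHom (dvd_mul_right m ℓ) (ZMod m) b') else 0) := by
    intro b'
    by_cases h0 : ZMod.castHom (dvd_mul_left ℓ m) (ZMod ℓ) b' = 0
    · have hnu : ¬ IsUnit b' := fun hu => by
        have := ((isUnit_iff_isUnit_castHom_and_dvd b').mp hu).2
        rw [h0] at this
        exact not_isUnit_zero this
      rw [MulChar.map_nonunit _ hnu, if_pos h0, sub_self]
    · rw [if_neg h0, sub_zero]
      have huℓ : IsUnit (ZMod.castHom (dvd_mul_left ℓ m) (ZMod ℓ) b') := isUnit_iff_ne_zero.mpr h0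
      by_cases hum : IsUnit (ZMod.castHom (dvd_mul_right m ℓ) (ZMod m) b')
      · have hu : IsUnit b' := (isUnit_iff_isUnit_castHom_and_dvd b').mpr ⟨hum, huℓ⟩
        obtain ⟨v, hv'⟩ := hum
        obtain ⟨u, hu'⟩ := hu
        rw [← hv', MulChar.one_apply_coe, ← hu', MulChar.one_apply_coe]
      · have hnu : ¬ IsUnit b' := fun hu => hum ((isUnit_iff_isUnit_castHom_and_dvd b').mp hu).1
        rw [MulChar.map_nonunit _ hnu, MulChar.map_nonunit _ hum]
  simp_rw [hA, sub_mul, Finset.sum_sub_distrib, ite_mul, zero_mul, ← Finset.sum_filter]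
  -- Step B: the first sum, fibrewise over `b mod m` (ONE term at `ℓ ∣ N`)
  have hB : ∑ b' : ZMod (m * ℓ), (1 : DirichletCharacter ℚ_[p] m) (ZMod.castHom (dvd_mul_right m ℓ) (ZMod m) b') *
      msdMeasureTame f (m * ℓ) α n a b' =
      ∑ b : ZMod m, (1 : DirichletCharacter ℚ_[p] m) b * ((aℓ : ℚ_[p]) * msdMeasureTame f m α n a b) := by
    rw [← Finset.sum_fiberwise Finset.univ (ZMod.castHom (dvd_mul_right m ℓ) (ZMod m))]
    refine Finset.sum_congr rfl fun b _ => ?_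
    rw [← sum_filter_msdMeasureTame_of_dvd f hf hrat hℓ hℓN haℓ hmp hℓp hℓm α a b, Finset.mul_sum]
    refine Finset.sum_congr rfl fun b' hb' => ?_
    rw [(Finset.mem_filter.mp hb').2]
  -- Step C: the second sum, over the classes `≡ 0 (mod ℓ)`
  have hinj : Function.Injective (fun b : ZMod m => (ℓ : ZMod (m * ℓ)) * (((b * (ℓ : ZMod m)⁻¹).val : ℕ) : ZMod (m * ℓ))) := by
    intro b₁ b₂ h
    have h1 := (castHom_liftZero_dvd (ℓ := ℓ) hℓm b₁).1
    have h2 := (castHom_liftZero_dvd (ℓ := ℓ) hℓm b₂).1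
    have := congrArg (ZMod.castHom (dvd_mul_right m ℓ) (ZMod m)) h
    simp only at this
    rw [h1, h2] at this
    exact this
  have hC : ∑ b' ∈ Finset.univ.filter (fun b' : ZMod (m * ℓ) => ZMod.castHom (dvd_mul_left ℓ m) (ZMod ℓ) b' = 0),
      (1 : DirichletCharacter ℚ_[p] m) (ZMod.castHom (dvd_mul_right m ℓ) (ZMod m) b') * msdMeasureTame f (m * ℓ) α n a b' =
      ∑ b : ZMod m, (1 : DirichletCharacter ℚ_[p] m) b *
        msdMeasureTame f m α n (a * (ℓ : ZMod (p ^ n))⁻¹) (b * (ℓ : ZMod m)⁻¹) := by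
    rw [filter_castHom_ell_eq_zero_eq_image_dvd hℓm, Finset.sum_image fun b₁ _ b₂ _ h => hinj h]
    refine Finset.sum_congr rfl fun b _ => ?_
    obtain ⟨h1, h2⟩ := castHom_liftZero_dvd (ℓ := ℓ) hℓm b
    rw [h1, msdMeasureTame_lift_dvd f hℓ hmp hℓp hℓm α a b _ h1 h2]
  rw [hB, hC]
  -- Step D: reindex `b ↦ bℓ⁻¹`
  have hone : ∀ b : ZMod m, ∀ v : (ZMod m)ˣ, (1 : DirichletCharacter ℚ_[p] m) (b * (v : ZMod m)) =
      (1 : DirichletCharacter ℚ_[p] m) b := by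
    intro b v
    rw [map_mul, MulChar.one_apply_coe, mul_one]
  have hD2 : ∑ b : ZMod m, (1 : DirichletCharacter ℚ_[p] m) b *
      msdMeasureTame f m α n (a * (ℓ : ZMod (p ^ n))⁻¹) (b * (ℓ : ZMod m)⁻¹) =
      ∑ b : ZMod m, (1 : DirichletCharacter ℚ_[p] m) b * msdMeasureTame f m α n (a * (ℓ : ZMod (p ^ n))⁻¹) b := by
    have hinv : (ℓ : ZMod m)⁻¹ = ((hℓu.unit⁻¹ : (ZMod m)ˣ) : ZMod m) := by
      rw [← ZMod.inv_coe_unit, IsUnit.unit_spec]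
    refine Fintype.sum_bijective (· * (ℓ : ZMod m)⁻¹) ?_ _ _ fun b => ?_
    · rw [hinv]; exact (Units.mulRight (hℓu.unit⁻¹)).bijective
    · rw [hinv, ← hone (b * ((hℓu.unit⁻¹ : (ZMod m)ˣ) : ZMod m)) hℓu.unit, mul_assoc, Units.inv_mul, mul_one]
  rw [Finset.mul_sum]
  simp_rw [← mul_assoc, mul_comm _ (aℓ : ℚ_[p]), mul_assoc]
  rw [hD2]

end Weighted

/-! ## §4. Matsuno's Lemma 3.3 at `ℓ ∣ N`: `L_p(f,α,𝟙_{mℓ}) = (a_ℓ − (1+T)^{c_ℓ}) · L_p(f,α,𝟙_m)` -/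

section EulerFactor

variable {N : ℕ} [NeZero N] {f : CuspForm (Gamma0 N) 2} {p : ℕ} [Fact p.Prime] {m ℓ : ℕ} [NeZero m] [NeZero (m * ℓ)]

/-- **Level-`n` form of Lemma 3.3 at `ℓ ∣ N`**: the Riemann sum of `L_p(f, α, 𝟙_{mℓ})` is `a_ℓ ·` that of `L_p(f, α, 𝟙_m)`
minus the Riemann sum of the `𝟙_m`-weighted measure translated by `ℓ⁻¹` (class `η_ℓ⁻¹ γ^{−c}`,
`classMap_inv_eq_inv_natCast`). [cite: Matsuno2000, Lemma 2.2 (p. 85) and Lemma 3.3 (pp. 87–88)] -/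
theorem padicLRiemannSumTame_mul_prime_eq_of_dvd (hf : IsNewform0 f)
    (hrat : ∀ r : ℚ, (ratPlusSymbol f r : ℝ) = normalizedPlusSymbol f r)
    (hℓ : ℓ.Prime) (hℓN : ℓ ∣ N) {aℓ : ℤ} (haℓ : cuspCoeff f ℓ = aℓ) (hmp : m.Coprime p) (hℓp : ℓ.Coprime p)
    (hℓm : ℓ.Coprime m) (α : ℚ_[p])
    {teich : rootsOfUnity (torsionOrder p) ℤ_[p]} {c : ℤ_[p]}
    (hc : ∀ n : ℕ, PadicInt.toZModPow (n + cyclotomicExponent p) ((teich : ℤ_[p]ˣ) : ℤ_[p]) *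
        (cyclotomicGenerator p : ZMod (p ^ (n + cyclotomicExponent p))) ^ (PadicInt.toZModPow n c).val =
          (ℓ : ZMod (p ^ (n + cyclotomicExponent p)))) (k n : ℕ) :
    padicLRiemannSumTame f (m * ℓ) α 1 k n =
      (aℓ : ℚ_[p]) * padicLRiemannSumTame f m α 1 k n -
      (∑ᶠ z : rootsOfUnity (torsionOrder p) ℤ_[p], ∑ s : ZMod (p ^ n),
        (∑ b : ZMod m, (1 : DirichletCharacter ℚ_[p] m) b * msdMeasureTame f m α (n + cyclotomicExponent p)
            ((PadicInt.toZModPow (n + cyclotomicExponent p) (((teich⁻¹ : rootsOfUnity (torsionOrder p) ℤ_[p]) : ℤ_[p]ˣ) : ℤ_[p]) *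
              (cyclotomicGenerator p : ZMod (p ^ (n + cyclotomicExponent p))) ^ (PadicInt.toZModPow n (-c)).val) *
            (PadicInt.toZModPow (n + cyclotomicExponent p) ((z : ℤ_[p]ˣ) : ℤ_[p]) *
              (cyclotomicGenerator p : ZMod (p ^ (n + cyclotomicExponent p))) ^ s.val)) b) *
          ((s.val.choose k : ℕ) : ℚ_[p])) := by
  classical
  haveI := neZero_torsionOrder p
  haveI := Fintype.ofFinite (rootsOfUnity (torsionOrder p) ℤ_[p])
  rw [padicLRiemannSumTame_eq_sum_weighted f α 1 k n, padicLRiemannSumTame_eq_sum_weighted f α 1 k n]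
  simp only [finsum_eq_sum_of_fintype, Finset.mul_sum, ← Finset.sum_sub_distrib]
  refine Finset.sum_congr rfl fun z _ ↦ Finset.sum_congr rfl fun s _ ↦ ?_
  rw [weighted_msdMeasureTame_levelChange_of_dvd f hf hrat hℓ hℓN haℓ hmp hℓp hℓm α]
  simp only [mul_comm _ ((ℓ : ZMod (p ^ (n + cyclotomicExponent p)))⁻¹)]
  rw [← classMap_inv_eq_inv_natCast hℓp hc n]
  ring

/-- **Matsuno 2000, Lemma 3.3 at `ℓ ∣ N`, coefficientwise.** For a rational normalised newform `f` of level `N` prime to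
`p`, `(m, p) = 1`, `α` the unit root, a prime `ℓ ∣ N` prime to `p` and to `m` with `a_ℓ(f) = a_ℓ`, and `ℓ ≡ η_ℓ γ^{c mod pⁿ}`:
`[T^k] L_p(f,α,𝟙_{mℓ}) = a_ℓ [T^k] L_p(f,α,𝟙_m) − ∑_{i≤k} (c choose k−i) [T^i] L_p(f,α,𝟙_m)`, i.e.
`L_p(f,α,𝟙_{mℓ}) = (a_ℓ − (1+T)^{c}) · L_p(f,α,𝟙_m)` (his `h_ℓ` with `ε(ℓ) = 0`). The `ℓ ∣ N` companion of
`padicLCoeffTame_mul_prime`. [cite: Matsuno2000, Lemma 3.3 (pp. 87–88)] [cite: MazurSwinnertonDyer1974Invent, §8 Lemma 2] -/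
theorem padicLCoeffTame_mul_prime_of_dvd (hf : IsNewform0 f) (hQ : coeffField f = ⊥) (hpN : ¬ p ∣ N)
    (hmp : m.Coprime p) {ap : ℤ} (hap : cuspCoeff f p = ap) {α : ℚ_[p]} (hα : α ^ 2 - ap * α + p = 0)
    (hαu : ‖α‖ = 1) (hℓ : ℓ.Prime) (hℓN : ℓ ∣ N) {aℓ : ℤ} (haℓ : cuspCoeff f ℓ = aℓ) (hℓp : ℓ.Coprime p)
    (hℓm : ℓ.Coprime m) {teich : rootsOfUnity (torsionOrder p) ℤ_[p]} {c : ℤ_[p]}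
    (hc : ∀ n : ℕ, PadicInt.toZModPow (n + cyclotomicExponent p) ((teich : ℤ_[p]ˣ) : ℤ_[p]) *
        (cyclotomicGenerator p : ZMod (p ^ (n + cyclotomicExponent p))) ^ (PadicInt.toZModPow n c).val =
          (ℓ : ZMod (p ^ (n + cyclotomicExponent p)))) (k : ℕ) :
    padicLCoeffTame f (m * ℓ) α 1 k =
      (aℓ : ℚ_[p]) * padicLCoeffTame f m α 1 k -
        ∑ i ∈ Finset.range (k + 1), algebraMap ℤ_[p] ℚ_[p] (Ring.choose c (k - i)) * padicLCoeffTame f m α 1 i := by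
  have hα0 : α ≠ 0 := norm_ne_zero_iff.mp (by rw [hαu]; exact one_ne_zero)
  have hrat : ∀ r : ℚ, (ratPlusSymbol f r : ℝ) = normalizedPlusSymbol f r := fun r ↦ ratCast_ratPlusSymbol_holds hf hQ r
  have hdist := sum_filter_weighted_msdMeasureTame_succ f hf hrat hpN hmp hap hα0 hα (1 : DirichletCharacter ℚ_[p] m)
  obtain ⟨C, hC⟩ := exists_norm_weighted_msdMeasureTame_le f
    (exists_nsmul_modularSymbol_mem_periodLattice_of_isNewform0 hf hQ) hαu (1 : DirichletCharacter ℚ_[p] m)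
  have hRS : ∀ k n : ℕ, padicLRiemannSumTame f m α 1 k n = _ := fun k n ↦ padicLRiemannSumTame_eq_sum_weighted f α 1 k n
  have hℓ'lim := tendsto_riemannSum_translate hdist hC hRS (fun k n ↦ rfl) k
    (RSz := fun k n ↦ ∑ᶠ z : rootsOfUnity (torsionOrder p) ℤ_[p], ∑ s : ZMod (p ^ n),
        (∑ b : ZMod m, (1 : DirichletCharacter ℚ_[p] m) b * msdMeasureTame f m α (n + cyclotomicExponent p)
            ((PadicInt.toZModPow (n + cyclotomicExponent p) (((teich⁻¹ : rootsOfUnity (torsionOrder p) ℤ_[p]) : ℤ_[p]ˣ) : ℤ_[p]) *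
              (cyclotomicGenerator p : ZMod (p ^ (n + cyclotomicExponent p))) ^ (PadicInt.toZModPow n (-c)).val) *
            (PadicInt.toZModPow (n + cyclotomicExponent p) ((z : ℤ_[p]ˣ) : ℤ_[p]) *
              (cyclotomicGenerator p : ZMod (p ^ (n + cyclotomicExponent p))) ^ s.val)) b) *
          ((s.val.choose k : ℕ) : ℚ_[p]))
  rw [neg_neg] at hℓ'lim
  have hmain := tendsto_padicLRiemannSumTame_holds hf hQ hpN hmp hap hα hαu (1 : DirichletCharacter ℚ_[p] m) k
  have hcomb : Tendsto (padicLRiemannSumTame f (m * ℓ) α 1 k) atTop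
      (𝓝 ((aℓ : ℚ_[p]) * padicLCoeffTame f m α 1 k -
        ∑ i ∈ Finset.range (k + 1), algebraMap ℤ_[p] ℚ_[p] (Ring.choose c (k - i)) *
          limUnder atTop (fun n ↦ padicLRiemannSumTame f m α 1 i n))) := by
    refine ((hmain.const_mul _).sub hℓ'lim).congr fun n ↦ ?_
    exact (padicLRiemannSumTame_mul_prime_eq_of_dvd hf hrat hℓ hℓN haℓ hmp hℓp hℓm α hc k n).symm
  rw [padicLCoeffTame, hcomb.limUnder_eq]
  rfl

/-- **Matsuno 2000, Lemma 3.3 at `ℓ ∣ N` as an identity of power series**: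
`L_p(f,α,𝟙_{mℓ}) = (C a_ℓ − (1+T)^{c}) · L_p(f,α,𝟙_m)` in `ℚ_p⟦T⟧` (`ℓ ≡ η_ℓ γ^{c}`). [cite: Matsuno2000, Lemma 3.3 (pp. 87–88)] -/
theorem padicLFunctionTame_mul_prime_of_dvd (hf : IsNewform0 f) (hQ : coeffField f = ⊥) (hpN : ¬ p ∣ N)
    (hmp : m.Coprime p) {ap : ℤ} (hap : cuspCoeff f p = ap) {α : ℚ_[p]} (hα : α ^ 2 - ap * α + p = 0)
    (hαu : ‖α‖ = 1) (hℓ : ℓ.Prime) (hℓN : ℓ ∣ N) {aℓ : ℤ} (haℓ : cuspCoeff f ℓ = aℓ) (hℓp : ℓ.Coprime p)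
    (hℓm : ℓ.Coprime m) {teich : rootsOfUnity (torsionOrder p) ℤ_[p]} {c : ℤ_[p]}
    (hc : ∀ n : ℕ, PadicInt.toZModPow (n + cyclotomicExponent p) ((teich : ℤ_[p]ˣ) : ℤ_[p]) *
        (cyclotomicGenerator p : ZMod (p ^ (n + cyclotomicExponent p))) ^ (PadicInt.toZModPow n c).val =
          (ℓ : ZMod (p ^ (n + cyclotomicExponent p)))) :
    padicLFunctionTame f (m * ℓ) α 1 =
      (C (aℓ : ℚ_[p]) - PowerSeries.binomialSeries ℚ_[p] c) * padicLFunctionTame f m α 1 := by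
  ext k
  have hB : ∀ c' : ℤ_[p], coeff k (PowerSeries.binomialSeries ℚ_[p] c' * padicLFunctionTame f m α 1) =
      ∑ i ∈ Finset.range (k + 1), algebraMap ℤ_[p] ℚ_[p] (Ring.choose c' (k - i)) * padicLCoeffTame f m α 1 i := by
    intro c'
    have h := coeff_C_mul_binomialSeries_mul 1 c' (padicLFunctionTame f m α 1) k
    rw [map_one, one_mul, one_mul] at h
    rw [h]
    refine Finset.sum_congr rfl fun i _ ↦ ?_
    rw [coeff_padicLFunctionTame]
  rw [coeff_padicLFunctionTame, padicLCoeffTame_mul_prime_of_dvd hf hQ hpN hmp hap hα hαu hℓ hℓN haℓ hℓp hℓm hc k,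
    sub_mul, map_sub, coeff_C_mul, coeff_padicLFunctionTame, hB]

omit [NeZero m] [NeZero (m * ℓ)] in
/-- `ι(C z) = C z` for an integer constant; private helper. [folklore] -/
private theorem iwasawaToPowerSeries_C_intCast' (z : ℤ) :
    iwasawaToPowerSeries p (C (z : ℤ_[p])) = C (z : ℚ_[p]) := by
  show PowerSeries.map _ (C _) = _
  rw [PowerSeries.map_C, map_intCast]

/-- **The factor `a_ℓ − (1+T)^{c}` is integral**: if `G ∈ Λ` lifts `L_p(f,α,𝟙_m)`, then `(C a_ℓ − (1+T)^{c}) · G ∈ Λ` lifts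
`L_p(f,α,𝟙_{mℓ})` (`ℓ ∣ N`). [cite: Matsuno2000, Lemma 3.3 (pp. 87–88)] -/
theorem iwasawaToPowerSeries_tameEulerFactor_mul_of_dvd (hf : IsNewform0 f) (hQ : coeffField f = ⊥) (hpN : ¬ p ∣ N)
    (hmp : m.Coprime p) {ap : ℤ} (hap : cuspCoeff f p = ap) {α : ℚ_[p]} (hα : α ^ 2 - ap * α + p = 0)
    (hαu : ‖α‖ = 1) (hℓ : ℓ.Prime) (hℓN : ℓ ∣ N) {aℓ : ℤ} (haℓ : cuspCoeff f ℓ = aℓ) (hℓp : ℓ.Coprime p)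
    (hℓm : ℓ.Coprime m) {teich : rootsOfUnity (torsionOrder p) ℤ_[p]} {c : ℤ_[p]}
    (hc : ∀ n : ℕ, PadicInt.toZModPow (n + cyclotomicExponent p) ((teich : ℤ_[p]ˣ) : ℤ_[p]) *
        (cyclotomicGenerator p : ZMod (p ^ (n + cyclotomicExponent p))) ^ (PadicInt.toZModPow n c).val =
          (ℓ : ZMod (p ^ (n + cyclotomicExponent p))))
    {G : IwasawaAlgebra p} (hG : iwasawaToPowerSeries p G = padicLFunctionTame f m α 1) :
    iwasawaToPowerSeries p ((C (aℓ : ℤ_[p]) - PowerSeries.binomialSeries ℤ_[p] c) * G) =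
      padicLFunctionTame f (m * ℓ) α 1 := by
  rw [map_mul, map_sub, hG, BurungaleSkinner2023.iwasawaToPowerSeries_binomialSeries,
    iwasawaToPowerSeries_C_intCast', padicLFunctionTame_mul_prime_of_dvd hf hQ hpN hmp hap hα hαu hℓ hℓN haℓ hℓp hℓm hc]

end EulerFactor

/-! ## §5. Depletion at a square-free tame level whose primes are prime to `N` or divide `N` -/

section Product

variable {N : ℕ} [NeZero N] {f : CuspForm (Gamma0 N) 2} {p : ℕ} [Fact p.Prime] {m ℓ : ℕ} [NeZero m] [NeZero (m * ℓ)]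

/-- **Lemma 3.3 at any prime `ℓ ∤ p·m` of a level-compatible tame set, uniform form**: for `ℓ` prime, `ℓ ∤ N` OR `ℓ ∣ N`,
`L_p(f,α,𝟙_{mℓ}) = (C a_ℓ − (1+T)^{c} − [ℓ ∤ N]·(1+T)^{−c}) · L_p(f,α,𝟙_m)` (`padicLFunctionTame_mul_prime` /
`padicLFunctionTame_mul_prime_of_dvd`). [cite: Matsuno2000, Lemma 3.3 (pp. 87–88)] -/
theorem padicLFunctionTame_mul_prime_ite (hf : IsNewform0 f) (hQ : coeffField f = ⊥) (hpN : ¬ p ∣ N)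
    (hmp : m.Coprime p) {ap : ℤ} (hap : cuspCoeff f p = ap) {α : ℚ_[p]} (hα : α ^ 2 - ap * α + p = 0)
    (hαu : ‖α‖ = 1) (hℓ : ℓ.Prime) {aℓ : ℤ} (haℓ : cuspCoeff f ℓ = aℓ) (hℓp : ℓ.Coprime p)
    (hℓm : ℓ.Coprime m) {teich : rootsOfUnity (torsionOrder p) ℤ_[p]} {c : ℤ_[p]}
    (hc : ∀ n : ℕ, PadicInt.toZModPow (n + cyclotomicExponent p) ((teich : ℤ_[p]ˣ) : ℤ_[p]) *
        (cyclotomicGenerator p : ZMod (p ^ (n + cyclotomicExponent p))) ^ (PadicInt.toZModPow n c).val =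
          (ℓ : ZMod (p ^ (n + cyclotomicExponent p)))) :
    padicLFunctionTame f (m * ℓ) α 1 =
      (C (aℓ : ℚ_[p]) - PowerSeries.binomialSeries ℚ_[p] c -
          (if ℓ ∣ N then 0 else PowerSeries.binomialSeries ℚ_[p] (-c))) * padicLFunctionTame f m α 1 := by
  by_cases hℓN : ℓ ∣ N
  · rw [if_pos hℓN, sub_zero]
    exact padicLFunctionTame_mul_prime_of_dvd hf hQ hpN hmp hap hα hαu hℓ hℓN haℓ hℓp hℓm hc
  · rw [if_neg hℓN, padicLFunctionTame_mul_prime hf hQ hpN hmp hap hα hαu hℓ hℓN haℓ hℓp hℓm hc]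
    ring

omit [NeZero m] [NeZero (m * ℓ)] in
/-- **Depletion at a square-free tame level meeting `N`** (Matsuno 2000, proof of Thm. 3.1 via Lemma 3.3, with `ε(ℓ) = 0` at the
primes of the level): for a finite set `S` of primes `ℓ ≠ p`, each either prime to `N` or dividing `N`, with `a_ℓ(f) = a ℓ` and
Teichmüller–exponent data `ℓ ≡ η_ℓ γ^{c ℓ}`, and `m = ∏_{ℓ∈S} ℓ`:
`L_p(f,α,𝟙_m) = (∏_{ℓ∈S} (C a_ℓ − (1+T)^{c_ℓ} − [ℓ ∤ N]·(1+T)^{−c_ℓ})) · L_p(f,α)` (induction on `S`; anchor `padicLFunctionTame_one`).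
The companion of `padicLFunctionTame_prod_primes` (all `ℓ ∤ N`). [cite: Matsuno2000, Lemma 3.3 and proof of Theorem 3.1 (pp. 87–88)] -/
theorem padicLFunctionTame_prod_primes_sqfreeAt (hf : IsNewform0 f) (hQ : coeffField f = ⊥) (hpN : ¬ p ∣ N)
    {ap : ℤ} (hap : cuspCoeff f p = ap) {α : ℚ_[p]} (hα : α ^ 2 - ap * α + p = 0) (hαu : ‖α‖ = 1)
    {a : ℕ → ℤ} {teich : ℕ → rootsOfUnity (torsionOrder p) ℤ_[p]} {c : ℕ → ℤ_[p]} :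
    ∀ (S : Finset ℕ), (∀ ℓ ∈ S, ℓ.Prime ∧ ℓ.Coprime p) → (∀ ℓ ∈ S, cuspCoeff f ℓ = a ℓ) →
      (∀ ℓ ∈ S, ∀ n : ℕ, PadicInt.toZModPow (n + cyclotomicExponent p) ((teich ℓ : ℤ_[p]ˣ) : ℤ_[p]) *
        (cyclotomicGenerator p : ZMod (p ^ (n + cyclotomicExponent p))) ^ (PadicInt.toZModPow n (c ℓ)).val =
          (ℓ : ZMod (p ^ (n + cyclotomicExponent p)))) →
      ∀ (m : ℕ) [NeZero m], m = ∏ ℓ ∈ S, ℓ →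
        padicLFunctionTame f m α 1 =
          (∏ ℓ ∈ S, (C ((a ℓ : ℤ) : ℚ_[p]) - PowerSeries.binomialSeries ℚ_[p] (c ℓ) -
              (if ℓ ∣ N then 0 else PowerSeries.binomialSeries ℚ_[p] (-c ℓ)))) * padicLFunction f α := by
  classical
  intro S
  induction S using Finset.induction_on with
  | empty =>
    intro _ _ _ m _ hm
    rw [Finset.prod_empty] at hm
    subst hm
    rw [Finset.prod_empty, one_mul, padicLFunctionTame_one]
  | @insert ℓ₀ S hℓ₀ ih =>
    intro hS ha hc m _ hm
    have hm' : m = (∏ ℓ ∈ S, ℓ) * ℓ₀ := by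
      rw [hm, ← Finset.prod_erase_mul _ _ (Finset.mem_insert_self ℓ₀ S), Finset.erase_insert hℓ₀]
    subst hm'
    have hS' : ∀ ℓ ∈ S, ℓ.Prime ∧ ℓ.Coprime p := fun ℓ h ↦ hS ℓ (Finset.mem_insert_of_mem h)
    obtain ⟨hℓ₀p, hℓ₀cp⟩ := hS ℓ₀ (Finset.mem_insert_self ℓ₀ S)
    haveI : NeZero (∏ ℓ ∈ S, ℓ) :=
      ⟨Finset.prod_ne_zero_iff.mpr fun ℓ h ↦ (hS' ℓ h).1.ne_zero⟩
    have hmp : (∏ ℓ ∈ S, ℓ).Coprime p := Nat.Coprime.prod_left fun ℓ h ↦ (hS' ℓ h).2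
    have hℓm : ℓ₀.Coprime (∏ ℓ ∈ S, ℓ) := by
      refine Nat.Coprime.prod_right fun ℓ h ↦ (Nat.coprime_primes hℓ₀p (hS' ℓ h).1).mpr ?_
      rintro rfl
      exact hℓ₀ h
    rw [Finset.prod_insert hℓ₀, mul_assoc,
      ← ih hS' (fun ℓ h ↦ ha ℓ (Finset.mem_insert_of_mem h)) (fun ℓ h ↦ hc ℓ (Finset.mem_insert_of_mem h)) _ rfl]
    exact padicLFunctionTame_mul_prime_ite hf hQ hpN hmp hap hα hαu hℓ₀p (ha ℓ₀ (Finset.mem_insert_self ℓ₀ S))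
      hℓ₀cp hℓm (hc ℓ₀ (Finset.mem_insert_self ℓ₀ S))

omit [NeZero m] [NeZero (m * ℓ)] in
/-- **`Λ`-form of the depletion at a square-free tame level meeting `N`**: with `S`, `m = ∏_{ℓ∈S} ℓ` as in
`padicLFunctionTame_prod_primes_sqfreeAt` and `G ∈ Λ` an integral lift of `L_p(f,α)`, the element
`(∏_{ℓ∈S} (C a_ℓ − (1+T)^{c_ℓ} − [ℓ ∤ N]·(1+T)^{−c_ℓ})) · G ∈ Λ` lifts `L_p(f,α,𝟙_m)`. [cite: Matsuno2000, Lemma 3.3 and proof of Theorem 3.1 (pp. 87–88)] -/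
theorem iwasawaToPowerSeries_prod_tameEulerFactor_mul_sqfreeAt (hf : IsNewform0 f) (hQ : coeffField f = ⊥) (hpN : ¬ p ∣ N)
    {ap : ℤ} (hap : cuspCoeff f p = ap) {α : ℚ_[p]} (hα : α ^ 2 - ap * α + p = 0) (hαu : ‖α‖ = 1)
    {a : ℕ → ℤ} {teich : ℕ → rootsOfUnity (torsionOrder p) ℤ_[p]} {c : ℕ → ℤ_[p]} {S : Finset ℕ}
    (hS : ∀ ℓ ∈ S, ℓ.Prime ∧ ℓ.Coprime p) (ha : ∀ ℓ ∈ S, cuspCoeff f ℓ = a ℓ)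
    (hc : ∀ ℓ ∈ S, ∀ n : ℕ, PadicInt.toZModPow (n + cyclotomicExponent p) ((teich ℓ : ℤ_[p]ˣ) : ℤ_[p]) *
        (cyclotomicGenerator p : ZMod (p ^ (n + cyclotomicExponent p))) ^ (PadicInt.toZModPow n (c ℓ)).val =
          (ℓ : ZMod (p ^ (n + cyclotomicExponent p))))
    {m : ℕ} [NeZero m] (hm : m = ∏ ℓ ∈ S, ℓ) {G : IwasawaAlgebra p}
    (hG : iwasawaToPowerSeries p G = padicLFunction f α) :
    iwasawaToPowerSeries p
        ((∏ ℓ ∈ S, (C ((a ℓ : ℤ) : ℤ_[p]) - PowerSeries.binomialSeries ℤ_[p] (c ℓ) -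
            (if ℓ ∣ N then 0 else PowerSeries.binomialSeries ℤ_[p] (-c ℓ)))) * G) = padicLFunctionTame f m α 1 := by
  rw [map_mul, map_prod, hG, padicLFunctionTame_prod_primes_sqfreeAt hf hQ hpN hap hα hαu S hS ha hc m hm]
  congr 1
  refine Finset.prod_congr rfl fun ℓ _ ↦ ?_
  rw [map_sub, map_sub, BurungaleSkinner2023.iwasawaToPowerSeries_binomialSeries, iwasawaToPowerSeries_C_intCast']
  congr 1
  split_ifs with h
  · rw [map_zero]
  · rw [BurungaleSkinner2023.iwasawaToPowerSeries_binomialSeries]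

end Product

end Literature.NumberTheory.EllipticCurves

end
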